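import Literature.MathematicalPhysics.QuantumFieldTheory.Balaban1983to89.B1Ineq233LowerBackgroundRegion

/-!
# `Balaban1983to89.B1Ineq233LowerRegularOnRegion` — T. Bałaban, *(Higgs)₂,₃ quantum fields in a finite volume. I. A lower bound*,
# Commun. Math. Phys. **85** (1982) 603–626 [Balaban1982Higgs1], PROPOSITION 2.3 (2.33) p. 611, LOWER HALF, FOR THE PRINTED
# REGIONS `Ω = B^k(Λ_k)` **WITH THE REGULARITY OF `A` ASKED ON `Ω` ONLY** — *"If a configuration A is regular on Ω in the sense
# defined in Proposition 2.1"*, (2.23) *"x ∈ Ω"* — on the concrete (Higgs)₂,₃ carrier: the torus file's staircase/holonomy toolkit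
# ([B4] §5 (5.2)–(5.3)) re-proved for a field regular on a coordinate WINDOW, hence on one `(k+1)`-block, hence on a union of
# blocks; removes HONEST SCOPE (ii) («regularity is assumed on all of T_ε») of r14 g13's `B1Ineq233LowerBackground{Torus,Region}`
# and matches the hypothesis of p23's (II.3.29) `B2Ineq329RegularField.ineq329_regular_deltaKA` (`∀ z ∈ pieceF R j`) exactly.

statement-level skeleton of published theorems with citation tags; proofs where landed; nothing here is a claim about the Yang–Mills mass gap

PDF held: `paper:balaban1982-cmp85-higgs23-i` (journal page = PDF page + 602): p. 610 [PDF 8] (Prop. 2.1, (2.23) «x ∈ Ω»), p. 611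
[PDF 9] (Prop. 2.3 (2.33) «regular on Ω»), p. 608 [PDF 6] ((2.1)–(2.3), (2.7)); `paper:balaban1983-cmp89-regularity-decay` (journal =
PDF + 570): p. 574 [PDF 4] (Prop. II.3.1′, (1.21) «|(∂^η_μA)(x)| ≦ O(1)p(e)» on `Ω`), p. 590 [PDF 20] (§4 «A = A₀ + A′»), p. 593
[PDF 23] (§5 (5.2)–(5.3)); `paper:balaban1982-cmp86-higgs23-ii` (journal = PDF + 554): p. 590 [PDF 36] ((3.29)).

CITATION HEADER (lean-in-tree rule).  Cell `lit-balaban` (HOME `run/shared/lean/pub/lit-balaban/`), reader/typer seat **r14**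
gen 13 (unit `lit-balaban-r14`, B1 fold owner; TAKING line HOME/STATUS.md 2026-08-22T03:19:04Z, free-target protocol G.5-34(d)),
SKELETON row **B1.Prop2.3** (member (2.33) lower half for regions at a regular background: r14 g13 `B1Ineq233LowerBackgroundRegion`
p318561, whose regularity hypothesis is global), input row **B2.Prop3.1** ((3.29) regular field for regions, p23 g11 p312469, hypothesis
already local); referee ref-1.  USED BY NAME, never restated: r14 g13 `B1Ineq233LowerBackgroundTorus.{corner_shiftN_right_of_le,
corner_shiftN_right_of_lt, toFinest_shift, val_corner_sub, sum_val_corner_sub_le, val_shiftN_corner_sub, siteInner_blockProjA_transport,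
segSum_add}` (p317716), `B1Ineq233LowerBackgroundRegion.sum_blocks_inside_le_inside_of` (p318561), p23's `B2Ineq329PrismHolonomy.
{shift_shiftN_comm, corner_eq_cornerN, shiftN_cornerN_succ, abs_sub_le_of_stair}`, `B2Ineq329BlockPoincare.{blockIter_succ_eq_of_window,
val_toFinest_le}` (the window ⇒ block-point lemma), `B2Ineq329ZeroAveraging.{shiftN_apply_self, shiftN_apply_ne, shift_shiftN, shiftN_zero'}`,
`B2Restr216Lattice.{cornerN, norm_U_apply}`, `B2Ineq329CovariantAveraging.{norm_U_apply_sub_le, U_apply_U, U_mesh_barA, sum_inside_tgt_le}`,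
`B2Ineq329RegularField.ineq329_regular_deltaKA`, p15 `B2Prop31ZeroFieldConcrete.{massK, massK_eq_siteInner, massK_nonneg,
extL_apply_of_not, mem_pieceF_iff}`, r14 g7 `B1Ineq233LowerZeroField.{block_poincare_vec, sum_ite_inside_block_le, mesh_succ}`, p35's
`B1Eq230FluctCov.{blockProjA, precOpA, deltaKA}`, the typer's `HiggsAveraging.{corner, contourSum, segSum, shiftN, toFinest, blockIter}`,
`HiggsCovariance.covDeriv`, `B2Eq255Concrete.barA`.

WHAT IS PRINTED (verbatim).  [B1] p. 610 [PDF 8]: *"Proposition 2.1. Let Ω ⊂ T_η be a sum of big blocks … and let a configuration A be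
regular on Ω in the sense that |(∂^η_μA^η_ν)(x)| ≦ c e(L^kε)^{β−1}, x ∈ Ω (2.23)"*; p. 611 [PDF 9]: *"Proposition 2.3. If a configuration
A is regular on Ω in the sense defined in Proposition 2.1, then there exist positive constants δ₀, c₀, γ₀, γ₁ dependent on d and a, and
independent of A, k, Ω and Λ, such that γ₀I ≦ aL^{−2}P(A) + Δ^{(k)}(Ω, A) ≦ γ₁I, (2.33)"*.  [B4] p. 574 [PDF 4]: *"Proposition 3.1′ of
[2]. Let Ω be a sum of unit blocks … and let A satisfies the condition |(∂^η_μA)(x)| ≦ O(1)p(e) (1.21) then …"*; p. 593 [PDF 23]: *"To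
prove the lower bound we apply Proposition II.3.1′ to Δ^{(k)}(Ω, A): … we separate the blocks by Neumann boundary conditions, in each
block we decompose A = A₀ + A′ … Next we “gauge away” the constant field …"*.

DICTIONARY (as in `B1Ineq233LowerBackgroundRegion`).  «A regular on Ω», (2.23) with `x ∈ Ω` ↦ `|A(z + εe_ν, μ′) − A(z, μ′)| ≦ δ` for the
sites `z ∈ T_ε` of `Ω = B^k(Λ_k)` (`z ∈ pieceF R j`, i.e. the `k`-block point of `z` lies in `Λ_k = R.block j`), in lattice units — the
hypothesis of p23's `ineq329_regular_deltaKA`, verbatim; as in print the difference quotient AT `x ∈ Ω` may involve the bond one step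
outside `Ω`.  Everything else as in the sibling files (`Ω = pieceF R j`, `ψ̃ = extL R j ψ`, `aL^{−2}P(A) + Δ^{(k)}(Ω, A) ↦ precOpA`).

WHAT THIS FILE PROVES (kernel-checked, zero `sorry`, standard axioms; theorems only — no definition, no `Prop`-valued fact):
* §1 `abs_segSum_shift_sub_le_of`, `abs_segSum_shiftN_sub_le_of` (segment sums under translation, regularity asked at the swept
  sites only), **`abs_hol_oneStep_le_of`**: the one-step prism holonomy `|A(Γ_{Y,X′}) − A(Γ_{Y,X}) − A([X, X′])| ≦ 2n(Σ_νm_ν)δ`,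
  `X′ = X + nεe_μ`, for a field regular on the coordinate WINDOW `Y ≦ z ≦ X′` (every site of both staircases and of every translated
  segment of the comparison is shown to lie in the window, coordinate by coordinate).
* §2 **`abs_hol_block_le_of`**, **`norm_transport_bond_sub_le_of`**: the in-block holonomy bound `2dL·L^{2k}δ` and the transport
  comparison `‖U(A(Γ_{y,x+e_μ}))ψ(x+e_μ) − U(A(Γ_{y,x}))ψ(x)‖ ≦ L^kε‖(D_{Ā^{(k)}}ψ)(b)‖ + θ‖ψ(x+e_μ)‖` for a field regular on the ONE
  `(k+1)`-block containing the bond (the window `[y~, (x+e_μ)~]` lies in the block: p23's `blockIter_succ_eq_of_window`).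
* §3 **`siteInner_self_le_blockProjA_add_cov_inside_of`**: the covariant block Poincaré inequality with only the bonds inside a union of
  blocks `S`, for `ψ` vanishing off `S` and `A` regular at the sites whose `k`-block point lies in `S`:
  `‖ψ‖² ≦ ⟨ψ, P(A)ψ⟩ + (L²/4)(L^kε)²Σ_{b⊂S}(L^kε)^d|(D_{Ā^{(k)}}ψ)(b)|² + (L²/4)dθ²‖ψ‖²`, `θ = 2dL·L^{2k}ε|e|δ`.
* §4 **`ineq233_lower_regularOn_region`**: for `Λ_k = R.block j` a union of blocks, `1 ≦ k = j+1 < K_P`, `L^kε ≦ 1`, `A` regular ON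
  `Ω = B^k(Λ_k)` (`∀ z ∈ pieceF R j`) with the three smallness conditions of the sibling files, and EVERY `ψ : Λ_k → ℝ^N`:
  `(c₁/2)(L^kε)^{−2}‖ψ̃‖² ≦ ⟨ψ̃, (a(L^{k+1}ε)^{−2}P(A) + Δ^{(k),L^kε}(B^k(Λ_k), A))ψ̃⟩`, `c₁ = min{a, 4γ₀}/L²` — the statement of
  `B1Ineq233LowerBackgroundRegion.ineq233_lower_regular_region` with print's hypothesis.
* §5 **`ineq233_lower_regularOn_region_levelZero`**: the level `k = 0` case for a union of blocks `Ω ⊂ T_ε`, `A` regular on `Ω` only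
  (`∀ z ∈ Ω`), every `ε`, `a, m² ≧ 0`: `(3c₁⁰/4)ε^{−2}‖ψ‖² ≦ ⟨ψ, (a(Lε)^{−2}P(A) + Δ^{(0),ε}(Ω, A))ψ⟩`, `c₁⁰ = min{a, 4}/L²`.
* §6 **`ineq233_lower_printed_region`** — THE PRINTED SHAPE: for `d, L, a, m²` and a regularity constant `c` there are `E₀ > 0`, `γ > 0`
  (functions of `d, L, a, m², c` only) such that for every charge with `e² ≦ E₀` («for e sufficiently small», [B4] p. 593), every torus,
  every region tower, every `1 ≦ k < K_P` with `L^kε ≦ 1`, every `A` regular on `Ω` with `L^k·δ ≦ c·|e|` ((2.23) in lattice units, `β ≧ 0`)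
  and every `ψ`: `γ(L^kε)^{−2}‖ψ̃‖² ≦ ⟨ψ̃, (a(L^{k+1}ε)^{−2}P(A) + Δ^{(k),L^kε}(B^k(Λ_k), A))ψ̃⟩` — «γ₀ dependent on d and a, independent of A, k, Ω
  and Λ» (here also on `L`, `m²`, `c`).
HONEST SCOPE.  (i) Regions `Ω = B^k(Λ_k)`, `Λ_k` a union of blocks (weaker than «big blocks»), `1 ≦ k < K_P` (§4, §6) and `k = 0` (§5);
regularity on `Ω` only, as printed; in §6 the (2.23) exponent enters only through `L^kδ ≦ c|e|` (true for `β ≧ 0`, `L^kε ≦ 1`).  (ii) Constants and smallness conditions as in the sibling files (`½min{aL^{−2}, 4γ₀L^{−2}}` for the printed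
`½γ₀min{π²L^{−2}, aL^{−2}}`; `γ₀` p23's explicit constant).  (iii) (2.34)/(2.36) for regions at `A ≠ 0` still need (2.27) at `A ≠ 0` for
regions — not claimed.  (iv) Value = kernel certificate of the printed §5 mechanism with the printed locality of the hypothesis; NOT
summit progress.  Unit `lit-balaban-r14-g13` (literature-prover-lit-balaban-r14-g13-0); HOME/FILED.md records the proposal.
-/

noncomputable section

open scoped BigOperators InnerProductSpace
open Finset

namespace Literature.MathematicalPhysics.QuantumFieldTheory.Balaban1983to89.B1Ineq233LowerRegularOnRegion

open HiggsLattice HiggsAveraging HiggsCovariance HiggsCovariancePos B1Eq230FluctCov B1Eq230FluctCovPos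
open B2Ineq329ZeroAveraging (shiftN_apply_self shiftN_apply_ne shiftN_add shiftN_zero' shift_shiftN sitesPerDir_zero_eq)
open B2Ineq329PrismHolonomy (shift_shiftN_comm val_toFinest corner_eq_cornerN shiftN_cornerN_succ abs_sub_le_of_stair)
open B2Restr216Lattice (cornerN val_blockOf norm_U_apply sitesPerDir_eq_mul mem_block_iff)
open B2Ineq329CovariantAveraging (norm_U_apply_sub_le U_apply_U U_mesh_barA sum_inside_tgt_le)
open B2Ineq329BlockPoincare (blockIter_succ_eq_of_window val_toFinest_le)
open B2Eq255Concrete (barA)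
open B1Ineq233LowerZeroField (block_poincare_vec sum_ite_inside_block_le)
open B1Ineq233LowerBackgroundRegion (sum_blocks_inside_le_inside_of)
open B1Ineq233LowerBackgroundTorus (corner_shiftN_right_of_le corner_shiftN_right_of_lt toFinest_shift
  val_corner_sub sum_val_corner_sub_le val_shiftN_corner_sub siteInner_blockProjA_transport)

variable {P : HiggsLattice.Params} {N : ℕ}

/-! ## §0 Two facts on labels in `ℤ/n` -/

/-- `(a + t) − b` has label `(a − b) + t` when this does not wrap around. [folklore] -/
private theorem val_add_nat_sub {n : ℕ} [NeZero n] (a b : ZMod n) (t : ℕ) (h : (a - b).val + t < n) :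
    (a + t - b).val = (a - b).val + t := by
  have ht : ((t : ℕ) : ZMod n).val = t := ZMod.val_natCast_of_lt (by omega)
  rw [add_sub_right_comm, ZMod.val_add_of_lt, ht]
  rw [ht]; exact h

/-- A relative window `(p − Y) ≤ (X − Y)` with `Y ≤ X` (labels) is the absolute window `Y ≤ p ≤ X`. [folklore] -/
private theorem val_window {n : ℕ} [NeZero n] (Y X p : ZMod n) (hYX : Y.val ≤ X.val) (hp : (p - Y).val ≤ (X - Y).val) :
    Y.val ≤ p.val ∧ p.val ≤ X.val := by
  have hXY : (X - Y).val = X.val - Y.val := ZMod.val_sub hYX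
  have hXlt := ZMod.val_lt X
  have hr : Y.val + (p - Y).val < n := by omega
  have e : p = Y + (p - Y) := by ring
  have hpv : p.val = Y.val + (p - Y).val := by
    conv_lhs => rw [e]
    exact ZMod.val_add_of_lt hr
  omega

/-! ## §1 Straight segments and the one-step staircase holonomy for a field regular ON A WINDOW -/

section Staircase

variable {A : HiggsLattice.VecField P 0} {δ : ℝ}

/-- A unit translation in direction `ν` moves the sum over the straight segment `[u, u + nεe_μ]` by at most `n·δ` when
`|A(z + εe_ν, μ) − A(z, μ)| ≤ δ` AT THE `n` SITES `z` OF THE SEGMENT (localized form of the torus file's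
`abs_segSum_shift_sub_le`). [cite: Balaban1983RegularityDecay, (1.21) p.574] [cite: Balaban1982Higgs1, (2.3) p.608, (2.23) p.610] -/
theorem abs_segSum_shift_sub_le_of (u : HiggsLattice.Site P 0) (μ ν : Fin P.d) (n : ℕ)
    (hG : ∀ t, t < n → |A ⟨(shiftN u μ t).shift ν, μ⟩ - A ⟨shiftN u μ t, μ⟩| ≤ δ) :
    |segSum A (u.shift ν) μ n - segSum A u μ n| ≤ n * δ := by
  unfold segSum
  rw [← Finset.sum_sub_distrib]
  refine (Finset.abs_sum_le_sum_abs _ _).trans ?_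
  calc ∑ i ∈ Finset.range n, |A ⟨shiftN (u.shift ν) μ i, μ⟩ - A ⟨shiftN u μ i, μ⟩|
      ≤ ∑ _i ∈ Finset.range n, δ := Finset.sum_le_sum fun i hi => by
        rw [← shift_shiftN_comm]
        exact hG i (Finset.mem_range.mp hi)
    _ = n * δ := by rw [Finset.sum_const, Finset.card_range, nsmul_eq_mul]

/-- A translation by `tεe_ν` moves the sum over `[u, u + nεe_μ]` by at most `t·n·δ` when the regularity holds at the `t·n`
swept sites (localized `abs_segSum_shiftN_sub_le`). [cite: Balaban1983RegularityDecay, (1.21) p.574] [cite: Balaban1982Higgs1, (2.3) p.608] -/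
theorem abs_segSum_shiftN_sub_le_of (u : HiggsLattice.Site P 0) (μ ν : Fin P.d) (n t : ℕ)
    (hG : ∀ s, s < t → ∀ r, r < n →
      |A ⟨(shiftN (shiftN u ν s) μ r).shift ν, μ⟩ - A ⟨shiftN (shiftN u ν s) μ r, μ⟩| ≤ δ) :
    |segSum A (shiftN u ν t) μ n - segSum A u μ n| ≤ t * n * δ := by
  induction t with
  | zero => simp [shiftN_zero']
  | succ t ih =>
    rw [← shift_shiftN]
    calc |segSum A ((shiftN u ν t).shift ν) μ n - segSum A u μ n|
        ≤ |segSum A ((shiftN u ν t).shift ν) μ n - segSum A (shiftN u ν t) μ n|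
            + |segSum A (shiftN u ν t) μ n - segSum A u μ n| := abs_sub_le _ _ _
      _ ≤ n * δ + t * n * δ :=
          add_le_add (abs_segSum_shift_sub_le_of _ μ ν n (hG t (Nat.lt_succ_self t)))
            (ih fun s hs r hr => hG s (Nat.lt_succ_of_lt hs) r hr)
      _ = ((t + 1 : ℕ) : ℝ) * n * δ := by push_cast; ring

/-- **THE ONE-STEP PRISM HOLONOMY FOR A FIELD REGULAR ON THE WINDOW `[Y, X + nεe_μ]`** (localized form of the torus file's
`abs_hol_oneStep_le`): `|A(Γ_{Y,X′}) − A(Γ_{Y,X}) − A([X, X′])| ≤ 2n·(Σ_ν m_ν)·δ`, `X′ = X + nεe_μ`, when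
`|A(z + εe_ν, μ′) − A(z, μ′)| ≤ δ` for the sites `z` of the coordinate box `Y ≤ z ≤ X′` (relative labels) — the box containing both
staircases and all the translated segments of the comparison. [cite: Balaban1983RegularityDecay, §4 p.590, §5 (5.2)–(5.3) p.593]
[cite: Balaban1982Higgs1, (2.1)–(2.3) p.608, (2.23) p.610] -/
theorem abs_hol_oneStep_le_of (hδ : 0 ≤ δ) (Y X : HiggsLattice.Site P 0) (μ : Fin P.d) (n : ℕ)
    (hwrap : ((shiftN X μ n) μ - Y μ).val = (X μ - Y μ).val + n)
    (hW : ∀ z : HiggsLattice.Site P 0, (∀ i, (z i - Y i).val ≤ ((shiftN X μ n) i - Y i).val) →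
      ∀ μ' ν : Fin P.d, |A ⟨z.shift ν, μ'⟩ - A ⟨z, μ'⟩| ≤ δ) :
    |contourSum A Y (shiftN X μ n) - contourSum A Y X - segSum A X μ n|
      ≤ 2 * n * (∑ ν : Fin P.d, ((X ν - Y ν).val : ℝ)) * δ := by
  classical
  set S : Fin P.d → ℝ := fun i => segSum A (corner Y X i) i (X i - Y i).val with hS
  set S' : Fin P.d → ℝ := fun i => segSum A (corner Y (shiftN X μ n) i) i ((shiftN X μ n) i - Y i).val with hS'
  set m : Fin P.d → ℝ := fun ν => ((X ν - Y ν).val : ℝ) with hm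
  have hm0 : ∀ ν, 0 ≤ m ν := fun ν => Nat.cast_nonneg _
  have hn0 : (0 : ℝ) ≤ n := Nat.cast_nonneg _
  have hnμ : (X μ - Y μ).val + n < P.sitesPerDir 0 μ := by rw [← hwrap]; exact ZMod.val_lt _
  -- membership in the window, by coordinates
  have hWin : ∀ z : HiggsLattice.Site P 0,
      (∀ j, j ≠ μ → z j = Y j ∨ z j = X j ∨ ∃ t : ℕ, t < (X j - Y j).val ∧ z j = Y j + t) →
      (z μ = Y μ ∨ ∃ s : ℕ, s ≤ n ∧ z μ = X μ + s) →
      ∀ μ' ν : Fin P.d, |A ⟨z.shift ν, μ'⟩ - A ⟨z, μ'⟩| ≤ δ := by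
    intro z hj hμ
    refine hW z fun i => ?_
    by_cases hi : i = μ
    · subst hi
      rw [hwrap]
      rcases hμ with h | ⟨s, hs, h⟩
      · rw [h, sub_self, ZMod.val_zero]; exact Nat.zero_le _
      · rw [h, val_add_nat_sub _ _ s (by omega)]; omega
    · rw [shiftN_apply_ne _ hi]
      rcases hj i hi with h | h | ⟨t, ht, h⟩
      · rw [h, sub_self, ZMod.val_zero]; exact Nat.zero_le _
      · rw [h]
      · rw [h, add_sub_right_comm, sub_self, zero_add, ZMod.val_natCast_of_lt (ht.trans (ZMod.val_lt _))]
        exact ht.le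
  -- (a) the terms `i ≠ μ`
  have hD : ∀ i, i ≠ μ → |S' i - S i| ≤ n * m i * δ := by
    intro i hi
    have hstep : ((shiftN X μ n) i - Y i).val = (X i - Y i).val := by rw [shiftN_apply_ne _ hi]
    rcases lt_or_gt_of_ne hi with hlt | hgt
    · -- `i < μ`: corner translated, same steps
      rw [hS', hS]
      dsimp only
      rw [hstep, corner_shiftN_right_of_lt Y X hlt]
      refine abs_segSum_shiftN_sub_le_of _ i μ _ n fun s hs r hr => hWin _ (fun j hj => ?_) ?_ i μ
      · by_cases hji : j = i
        · subst hji
          refine Or.inr (Or.inr ⟨r, hr, ?_⟩)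
          rw [shiftN_apply_self, shiftN_apply_ne _ hi]
          simp [corner]
        · rw [shiftN_apply_ne _ hji, shiftN_apply_ne _ hj]
          by_cases hle : j ≤ i
          · exact Or.inl (by simp [corner, hle])
          · exact Or.inr (Or.inl (by simp [corner, hle]))
      · refine Or.inr ⟨s, hs.le, ?_⟩
        rw [shiftN_apply_ne _ (Ne.symm hi), shiftN_apply_self]
        have : ¬ μ ≤ i := not_le.mpr hlt
        simp [corner, this]
    · -- `μ < i`: identical terms
      rw [hS', hS]
      dsimp only
      rw [hstep, corner_shiftN_right_of_le Y X hgt.le, sub_self, abs_zero]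
      exact mul_nonneg (mul_nonneg hn0 (hm0 i)) hδ
  -- (b) the `μ`-term: prolongation by the translated segment
  have hDμ : S' μ - S μ = segSum A (cornerN Y X μ) μ n := by
    rw [hS', hS]
    dsimp only
    rw [hwrap, corner_shiftN_right_of_le Y X le_rfl, B1Ineq233LowerBackgroundTorus.segSum_add, corner_eq_cornerN,
      shiftN_cornerN_succ]
    ring
  have hτ : |segSum A (cornerN Y X μ) μ n - segSum A X μ n| ≤ (∑ ν, m ν) * (n * δ) := by
    rw [abs_sub_comm]
    have h := abs_sub_le_of_stair (fun q => segSum A q μ n) (cornerN Y X μ) X (δ := n * δ)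
      (fun ν s hs => abs_segSum_shift_sub_le_of _ μ ν n fun t ht => by
        -- the site `q + tεe_μ`, `q` on the `ν`-segment of the staircase from `cornerN μ` to `X`
        have hνμ : (ν : ℕ) < μ := by
          by_contra hge
          have : (X ν - (cornerN Y X μ) ν).val = 0 := by
            simp only [cornerN, if_neg hge, sub_self, ZMod.val_zero]
          omega
        have hνμ' : ν ≠ μ := fun h => by rw [h] at hνμ; exact lt_irrefl _ hνμ
        refine hWin _ (fun j hj => ?_) ?_ μ ν
        · rw [shiftN_apply_ne _ hj]
          by_cases hjν : j = ν
          · subst hjν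
            refine Or.inr (Or.inr ⟨s, ?_, ?_⟩)
            · have e : (cornerN Y X μ) j = Y j := by simp [cornerN, hνμ]
              rwa [e] at hs
            · rw [shiftN_apply_self]
              simp [cornerN, hνμ]
          · rw [shiftN_apply_ne _ hjν]
            simp only [cornerN]
            split_ifs
            · exact Or.inl rfl
            · exact Or.inr (Or.inl rfl)
            · exact Or.inr (Or.inl rfl)
        · refine Or.inr ⟨t, ht.le, ?_⟩
          rw [shiftN_apply_self, shiftN_apply_ne _ (Ne.symm hνμ')]
          have h1 : ¬ ((μ : ℕ) < ν + 1) := by omega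
          simp [cornerN, h1])
    refine h.trans (mul_le_mul_of_nonneg_right (Finset.sum_le_sum fun ν _ => ?_) (mul_nonneg hn0 hδ))
    rw [hm]
    dsimp only [cornerN]
    split_ifs with hν
    · exact le_rfl
    · rw [sub_self, ZMod.val_zero, Nat.cast_zero]
      exact Nat.cast_nonneg _
  -- (c) assemble
  have hsum : contourSum A Y (shiftN X μ n) - contourSum A Y X - segSum A X μ n
      = (S' μ - S μ - segSum A X μ n) + ∑ i ∈ Finset.univ.erase μ, (S' i - S i) := by
    unfold contourSum
    rw [show (∑ i, segSum A (corner Y (shiftN X μ n) i) i ((shiftN X μ n) i - Y i).val) = ∑ i, S' i from rfl,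
      show (∑ i, segSum A (corner Y X i) i (X i - Y i).val) = ∑ i, S i from rfl,
      ← Finset.sum_sub_distrib, ← Finset.add_sum_erase _ _ (Finset.mem_univ μ)]
    ring
  rw [hsum, hDμ]
  calc |segSum A (cornerN Y X μ) μ n - segSum A X μ n + ∑ i ∈ Finset.univ.erase μ, (S' i - S i)|
      ≤ |segSum A (cornerN Y X μ) μ n - segSum A X μ n| + |∑ i ∈ Finset.univ.erase μ, (S' i - S i)| := abs_add_le _ _
    _ ≤ (∑ ν, m ν) * (n * δ) + ∑ i ∈ Finset.univ.erase μ, n * m i * δ := by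
        refine add_le_add hτ ((Finset.abs_sum_le_sum_abs _ _).trans (Finset.sum_le_sum fun i hi => ?_))
        exact hD i (Finset.ne_of_mem_erase hi)
    _ ≤ (∑ ν, m ν) * (n * δ) + ∑ i, n * m i * δ := by
        refine add_le_add le_rfl (Finset.sum_le_sum_of_subset_of_nonneg (Finset.erase_subset _ _) fun i _ _ => ?_)
        exact mul_nonneg (mul_nonneg hn0 (hm0 i)) hδ
    _ = 2 * n * (∑ ν, m ν) * δ := by rw [← Finset.sum_mul, ← Finset.mul_sum]; ring

end Staircase

/-! ## §2 The one-step holonomy and the block transports for a field regular on ONE `(k+1)`-block -/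

section Block

variable {k : ℕ}

/-- **The one-step holonomy inside a block, field regular on that block only**: for `x, x + e_μ` in the same `(k+1)`-block
(block point `y`), `k < K`, at least two `(k+1)`-sites per direction, and `|A(z + εe_ν, μ′) − A(z, μ′)| ≤ δ` for the sites `z`
of `T_ε` with `(k+1)`-block point `y` (print: «regular on Ω», (2.23)):
`|A(Γ_{y,x+e_μ}) − A(Γ_{y,x}) − A([x~, x~ + Lᵏεe_μ])| ≤ 2dL·L^{2k}·δ` (localized `abs_hol_block_le`; the window `[y~, (x+e_μ)~]`
lies in the block, p23's `blockIter_succ_eq_of_window`). [cite: Balaban1983RegularityDecay, §5 (5.2)–(5.3) p.593, §4 p.590]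
[cite: Balaban1982Higgs1, (2.7) p.608, (2.23) p.610, (1.17) p.606] -/
theorem abs_hol_block_le_of (hk : k < P.K) (hN2 : ∀ μ, 2 ≤ P.sitesPerDir (k + 1) μ) {A : HiggsLattice.VecField P 0}
    {δ : ℝ} (hδ : 0 ≤ δ) (x : HiggsLattice.Site P k) (μ : Fin P.d)
    (hx : HiggsLattice.blockOf (x.shift μ) = HiggsLattice.blockOf x)
    (hreg : ∀ z : HiggsLattice.Site P 0, blockIter (k + 1) z = HiggsLattice.blockOf x →
      ∀ μ' ν : Fin P.d, |A ⟨z.shift ν, μ'⟩ - A ⟨z, μ'⟩| ≤ δ) :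
    |contourSum A (toFinest (HiggsLattice.blockOf x)) (toFinest (x.shift μ))
        - contourSum A (toFinest (HiggsLattice.blockOf x)) (toFinest x) - segSum A (toFinest x) μ (P.L ^ k)|
      ≤ 2 * P.d * P.L * ((P.L : ℝ) ^ k) ^ 2 * δ := by
  have hx' : x.shift μ ∈ HiggsLattice.block (HiggsLattice.blockOf x) := by
    simp only [HiggsLattice.block, Finset.mem_filter, Finset.mem_univ, true_and]
    exact hx
  have hW : ∀ z : HiggsLattice.Site P 0,
      (∀ i, (z i - (toFinest (HiggsLattice.blockOf x)) i).val
        ≤ ((shiftN (toFinest x) μ (P.L ^ k)) i - (toFinest (HiggsLattice.blockOf x)) i).val) →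
      ∀ μ' ν : Fin P.d, |A ⟨z.shift ν, μ'⟩ - A ⟨z, μ'⟩| ≤ δ := by
    intro z hz
    refine hreg z (blockIter_succ_eq_of_window hk hx' z fun i => ?_)
    have h := hz i
    rw [← toFinest_shift hk.le] at h
    exact val_window _ _ _ (val_toFinest_le hk hx' i) h
  rw [toFinest_shift hk.le]
  have h := abs_hol_oneStep_le_of hδ (toFinest (HiggsLattice.blockOf x)) (toFinest x) μ (P.L ^ k)
    (val_shiftN_corner_sub hk (hN2 μ) x) hW
  refine h.trans ?_
  have hs := sum_val_corner_sub_le hk x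
  have hn : (0 : ℝ) ≤ ((P.L ^ k : ℕ) : ℝ) := Nat.cast_nonneg _
  push_cast at hn ⊢
  calc 2 * (P.L : ℝ) ^ k * (∑ ν : Fin P.d, (((toFinest x) ν - (toFinest (HiggsLattice.blockOf x)) ν).val : ℝ)) * δ
      ≤ 2 * (P.L : ℝ) ^ k * (P.d * P.L * (P.L : ℝ) ^ k) * δ :=
        mul_le_mul_of_nonneg_right (mul_le_mul_of_nonneg_left hs (by positivity)) hδ
    _ = 2 * P.d * P.L * ((P.L : ℝ) ^ k) ^ 2 * δ := by ring

variable (C : ChargeData N)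

/-- **The block transports across an in-block bond, field regular on that block only** (localized
`norm_transport_bond_sub_le`): for `b = ⟨x, x + e_μ⟩` inside one `(k+1)`-block with block point `y` and
`|A(z + εe_ν, μ′) − A(z, μ′)| ≤ δ` for the sites `z` of `B^{k+1}(y)`,
`‖U(A(Γ_{y,x+e_μ}))ψ(x + e_μ) − U(A(Γ_{y,x}))ψ(x)‖ ≤ Lᵏε·‖(D_{Ā^{(k)}}ψ)(b)‖ + 2dL·L^{2k}·ε|e|δ·‖ψ(x + e_μ)‖`.
[cite: Balaban1983RegularityDecay, §5 (5.2)–(5.3) p.593] [cite: Balaban1982Higgs1, (1.7) p.605, (2.7) p.608, (2.23) p.610]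
[cite: Balaban1982Higgs2, (2.55) p.570] -/
theorem norm_transport_bond_sub_le_of (hk : k < P.K) (hN2 : ∀ μ, 2 ≤ P.sitesPerDir (k + 1) μ)
    {A : HiggsLattice.VecField P 0} {δ : ℝ} (hδ : 0 ≤ δ)
    (ψ : ScalarField P k N) (b : HiggsLattice.PBond P k) (hb : HiggsLattice.blockOf b.tgt = HiggsLattice.blockOf b.src)
    (hreg : ∀ z : HiggsLattice.Site P 0, blockIter (k + 1) z = HiggsLattice.blockOf b.src →
      ∀ μ' ν : Fin P.d, |A ⟨z.shift ν, μ'⟩ - A ⟨z, μ'⟩| ≤ δ) :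
    ‖C.U (P.mesh 0) (contourSum A (toFinest (HiggsLattice.blockOf b.tgt)) (toFinest b.tgt)) (ψ b.tgt)
        - C.U (P.mesh 0) (contourSum A (toFinest (HiggsLattice.blockOf b.src)) (toFinest b.src)) (ψ b.src)‖
      ≤ P.mesh k * ‖covDeriv C (barA k A) ψ b‖
        + 2 * P.d * P.L * ((P.L : ℝ) ^ k) ^ 2 * (P.mesh 0 * |C.e|) * δ * ‖ψ b.tgt‖ := by
  rw [hb]
  have hm : 0 < P.mesh k := P.mesh_pos k
  have hhol : |contourSum A (toFinest (HiggsLattice.blockOf b.src)) (toFinest b.tgt)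
      - contourSum A (toFinest (HiggsLattice.blockOf b.src)) (toFinest b.src) - segSum A (toFinest b.src) b.dir (P.L ^ k)|
      ≤ 2 * P.d * P.L * ((P.L : ℝ) ^ k) ^ 2 * δ := abs_hol_block_le_of hk hN2 hδ b.src b.dir hb hreg
  -- the abelian transport algebra: `U(Γ′)w′ − U(Γ)w` against `U(σ)w′ − w`, `σ` the straight bond
  have key : ∀ (Γ Γ' σ : ℝ) (w w' : EuclideanSpace ℝ (Fin N)),
      ‖C.U (P.mesh 0) Γ' w' - C.U (P.mesh 0) Γ w‖
        ≤ ‖C.U (P.mesh 0) σ w' - w‖ + |P.mesh 0 * C.e * (Γ' - Γ - σ)| * ‖w'‖ := by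
    intro Γ Γ' σ w w'
    have e1 : ‖C.U (P.mesh 0) Γ' w' - C.U (P.mesh 0) Γ w‖ = ‖C.U (P.mesh 0) (Γ' - Γ) w' - w‖ := by
      rw [← norm_U_apply C (P.mesh 0) (-Γ) (C.U (P.mesh 0) Γ' w' - C.U (P.mesh 0) Γ w), map_sub, U_apply_U, U_apply_U,
        neg_add_cancel, C.U_zero, one_apply_eq_self, neg_add_eq_sub]
    have e2 : C.U (P.mesh 0) (Γ' - Γ) w' - w
        = (C.U (P.mesh 0) σ w' - w) + C.U (P.mesh 0) σ (C.U (P.mesh 0) (Γ' - Γ - σ) w' - w') := by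
      rw [map_sub, U_apply_U, show σ + (Γ' - Γ - σ) = Γ' - Γ by ring]
      abel
    rw [e1, e2]
    refine (norm_add_le _ _).trans (add_le_add le_rfl ?_)
    rw [norm_U_apply]
    exact norm_U_apply_sub_le C (P.mesh 0) _ w'
  refine (key _ _ (segSum A (toFinest b.src) b.dir (P.L ^ k)) _ _).trans (add_le_add ?_ ?_)
  · -- the straight bond: `U_ε(σ) = U_{Lᵏε}(Ā_b)` and the covariant derivative (1.7)
    rw [← U_mesh_barA C A b]
    have e3 : C.U (P.mesh k) (barA k A b) (ψ b.tgt) - ψ b.src = P.mesh k • covDeriv C (barA k A) ψ b := by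
      rw [covDeriv, smul_smul, mul_inv_cancel₀ hm.ne', one_smul]
    rw [e3, norm_smul, Real.norm_eq_abs, abs_of_pos hm]
  · -- the holonomy defect
    rw [abs_mul, abs_mul, abs_of_pos (P.mesh_pos 0)]
    have h00 : 0 ≤ P.mesh 0 * |C.e| := mul_nonneg (P.mesh_pos 0).le (abs_nonneg _)
    exact (mul_le_mul_of_nonneg_right (mul_le_mul_of_nonneg_left hhol h00) (norm_nonneg _)).trans_eq (by ring)

end Block

/-! ## §3 The covariant block Poincaré inequality inside a union of blocks, field regular THERE -/

section Inside

variable {k : ℕ} (C : ChargeData N)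

/-- **THE COVARIANT BLOCK POINCARÉ INEQUALITY WITH ONLY THE BONDS INSIDE A UNION OF BLOCKS `S`, FOR A FIELD REGULAR ON `S`**
(print: «A regular on Ω», (2.23)): as `B1Ineq233LowerBackgroundRegion.siteInner_self_le_blockProjA_add_cov_inside`, but the
regularity `|A(z + εe_ν, μ′) − A(z, μ′)| ≤ δ` is asked only at the sites `z ∈ T_ε` whose `k`-block point lies in `S` — each in-block
bond of a block inside `S` is handled by §2 on its own block, and the blocks off `S` carry `ψ = 0`.
[cite: Balaban1983RegularityDecay, §5 (5.2)–(5.3) p.593, (2.27) p.580] [cite: Balaban1982Higgs1, Prop. 2.3 (2.33) p.611, (2.23) p.610] -/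
theorem siteInner_self_le_blockProjA_add_cov_inside_of (hk : k < P.K) (hN2 : ∀ μ, 2 ≤ P.sitesPerDir (k + 1) μ)
    (S : Finset (HiggsLattice.Site P k))
    (hS : ∀ x x' : HiggsLattice.Site P k, HiggsLattice.blockOf x = HiggsLattice.blockOf x' → (x ∈ S ↔ x' ∈ S))
    (A : HiggsLattice.VecField P 0) {δ : ℝ} (hδ : 0 ≤ δ)
    (hreg : ∀ z : HiggsLattice.Site P 0, blockIter k z ∈ S → ∀ μ' ν : Fin P.d, |A ⟨z.shift ν, μ'⟩ - A ⟨z, μ'⟩| ≤ δ)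
    (ψ : ScalarField P k N) (hψ : ∀ x, x ∉ S → ψ x = 0) :
    siteInner ψ ψ ≤ siteInner ψ (blockProjA C A k ψ)
      + (P.L : ℝ) ^ 2 / 4 * P.mesh k ^ 2 *
          (∑ b : HiggsLattice.PBond P k, if Inside S b then P.mesh k ^ P.d * ‖covDeriv C (barA k A) ψ b‖ ^ 2 else 0)
      + (P.L : ℝ) ^ 2 / 4 * P.d * (2 * P.d * P.L * ((P.L : ℝ) ^ k) ^ 2 * (P.mesh 0 * |C.e|) * δ) ^ 2 * siteInner ψ ψ := by
  classical
  obtain ⟨θ, hθ⟩ : ∃ θ : ℝ, θ = 2 * P.d * P.L * ((P.L : ℝ) ^ k) ^ 2 * (P.mesh 0 * |C.e|) * δ := ⟨_, rfl⟩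
  rw [← hθ]
  obtain ⟨ψ', hψ'⟩ : ∃ ψ' : ScalarField P k N,
      ψ' = fun x => C.U (P.mesh 0) (contourSum A (toFinest (HiggsLattice.blockOf x)) (toFinest x)) (ψ x) := ⟨_, rfl⟩
  have hm : 0 < P.mesh k := P.mesh_pos k
  have hmd : 0 < P.mesh k ^ P.d := pow_pos hm _
  have hnorm : ∀ x, ‖ψ' x‖ = ‖ψ x‖ := fun x => by rw [hψ']; exact norm_U_apply C _ _ _
  -- per in-block bond: `‖ψ′(b₊) − ψ′(b₋)‖² ≤ 2(Lᵏε)²‖(Dψ)(b)‖² + 2θ²‖ψ(b₊)‖²`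
  have hbond : ∀ b : HiggsLattice.PBond P k, HiggsLattice.blockOf b.tgt = HiggsLattice.blockOf b.src →
      ‖ψ' b.tgt - ψ' b.src‖ ^ 2
        ≤ 2 * (P.mesh k ^ 2 * ‖covDeriv C (barA k A) ψ b‖ ^ 2) + 2 * (θ ^ 2 * ‖ψ b.tgt‖ ^ 2) := by
    intro b hb
    by_cases hsrc : b.src ∈ S
    · -- the field is regular on the `(k+1)`-block of `b` (a block inside `S`)
      have hregB : ∀ z : HiggsLattice.Site P 0, blockIter (k + 1) z = HiggsLattice.blockOf b.src →
          ∀ μ' ν : Fin P.d, |A ⟨z.shift ν, μ'⟩ - A ⟨z, μ'⟩| ≤ δ := by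
        intro z hz
        refine hreg z (((hS (blockIter k z) b.src ?_)).mpr hsrc)
        rw [← hz]; rfl
      have h := norm_transport_bond_sub_le_of C hk hN2 hδ ψ b hb hregB
      rw [← hθ] at h
      have h' : ‖ψ' b.tgt - ψ' b.src‖ ≤ P.mesh k * ‖covDeriv C (barA k A) ψ b‖ + θ * ‖ψ b.tgt‖ := by
        rw [hψ']; exact h
      have h0 : 0 ≤ ‖ψ' b.tgt - ψ' b.src‖ := norm_nonneg _
      have hsq : ‖ψ' b.tgt - ψ' b.src‖ ^ 2
          ≤ 2 * (P.mesh k * ‖covDeriv C (barA k A) ψ b‖) ^ 2 + 2 * (θ * ‖ψ b.tgt‖) ^ 2 := by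
        nlinarith [mul_nonneg h0 (sub_nonneg.mpr h'), mul_nonneg (h0.trans h') (sub_nonneg.mpr h'),
          sq_nonneg (P.mesh k * ‖covDeriv C (barA k A) ψ b‖ - θ * ‖ψ b.tgt‖)]
      rw [mul_pow, mul_pow] at hsq
      exact hsq
    · -- both ends off `S`: the transported field vanishes there
      have htgt : b.tgt ∉ S := fun h => hsrc ((hS b.tgt b.src hb).mp h)
      have e0 : ψ' b.tgt - ψ' b.src = 0 := by
        rw [hψ']
        simp only [hψ _ hsrc, hψ _ htgt, map_zero, sub_zero]
      rw [e0, norm_zero, sq, mul_zero]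
      positivity
  -- an in-block bond with both ends off `S` carries `(Dψ)(b) = 0`
  have hD0 : ∀ b : HiggsLattice.PBond P k, b.src ∉ S → b.tgt ∉ S →
      2 * (P.mesh k ^ 2 * ‖covDeriv C (barA k A) ψ b‖ ^ 2) = 0 := by
    intro b hs ht
    rw [covDeriv, hψ _ hs, hψ _ ht, map_zero, sub_zero, smul_zero, norm_zero]
    ring
  -- (1) `‖ψ‖²` block by block
  have h1 : siteInner ψ ψ = P.mesh k ^ P.d * ∑ y : HiggsLattice.Site P (k + 1), ∑ x ∈ HiggsLattice.block y, ‖ψ x‖ ^ 2 := by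
    rw [siteInner, ← Finset.mul_sum]
    congr 1
    simp_rw [real_inner_self_eq_norm_sq]
    exact (Finset.sum_fiberwise_of_maps_to (s := Finset.univ) (t := Finset.univ)
      (g := fun x : HiggsLattice.Site P k => HiggsLattice.blockOf x) (fun _ _ => Finset.mem_univ _) _).symm
  -- (2) `⟨ψ, P(A)ψ⟩`
  have h2 : siteInner ψ (blockProjA C A k ψ) = P.mesh k ^ P.d * (((P.L : ℝ) ^ P.d)⁻¹ *
      ∑ y : HiggsLattice.Site P (k + 1), ‖∑ x ∈ HiggsLattice.block y, ψ' x‖ ^ 2) := by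
    rw [hψ']; exact siteInner_blockProjA_transport C A ψ
  -- (3) the inside bond form
  have h3 : (∑ b : HiggsLattice.PBond P k, if Inside S b then P.mesh k ^ P.d * ‖covDeriv C (barA k A) ψ b‖ ^ 2 else 0)
      = P.mesh k ^ P.d * ∑ b : HiggsLattice.PBond P k, (if Inside S b then ‖covDeriv C (barA k A) ψ b‖ ^ 2 else 0) := by
    rw [Finset.mul_sum]
    refine Finset.sum_congr rfl fun b _ => ?_
    split_ifs <;> simp
  -- (4) the in-block bond sums
  have h4 : ∑ y : HiggsLattice.Site P (k + 1), ∑ b : HiggsLattice.PBond P k,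
      (if Inside (HiggsLattice.block y) b then ‖ψ' b.tgt - ψ' b.src‖ ^ 2 else 0)
      ≤ (∑ b : HiggsLattice.PBond P k, (if Inside S b then 2 * (P.mesh k ^ 2 * ‖covDeriv C (barA k A) ψ b‖ ^ 2) else 0))
        + ∑ y : HiggsLattice.Site P (k + 1), ((P.d : ℝ) * ∑ x ∈ HiggsLattice.block y, 2 * (θ ^ 2 * ‖ψ x‖ ^ 2)) := by
    have hα : ∀ y : HiggsLattice.Site P (k + 1), ∑ b : HiggsLattice.PBond P k,
        (if Inside (HiggsLattice.block y) b then ‖ψ' b.tgt - ψ' b.src‖ ^ 2 else 0)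
        ≤ (∑ b : HiggsLattice.PBond P k,
            (if Inside (HiggsLattice.block y) b then 2 * (P.mesh k ^ 2 * ‖covDeriv C (barA k A) ψ b‖ ^ 2) else 0))
          + ∑ b : HiggsLattice.PBond P k,
            (if Inside (HiggsLattice.block y) b then 2 * (θ ^ 2 * ‖ψ b.tgt‖ ^ 2) else 0) := by
      intro y
      rw [← Finset.sum_add_distrib]
      refine Finset.sum_le_sum fun b _ => ?_
      split_ifs with hin
      · have hs := hin.1
        have ht := hin.2
        simp only [HiggsLattice.block, Finset.mem_filter, Finset.mem_univ, true_and] at hs ht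
        exact hbond b (by rw [hs, ht])
      · simp
    have hβ : ∀ y : HiggsLattice.Site P (k + 1), ∑ b : HiggsLattice.PBond P k,
        (if Inside (HiggsLattice.block y) b then 2 * (θ ^ 2 * ‖ψ b.tgt‖ ^ 2) else 0)
        ≤ (P.d : ℝ) * ∑ x ∈ HiggsLattice.block y, 2 * (θ ^ 2 * ‖ψ x‖ ^ 2) := fun y =>
      sum_inside_tgt_le (HiggsLattice.block y) (fun x => 2 * (θ ^ 2 * ‖ψ x‖ ^ 2)) fun x => by positivity
    have hγ : ∑ y : HiggsLattice.Site P (k + 1), ∑ b : HiggsLattice.PBond P k,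
        (if Inside (HiggsLattice.block y) b then 2 * (P.mesh k ^ 2 * ‖covDeriv C (barA k A) ψ b‖ ^ 2) else 0)
        ≤ ∑ b : HiggsLattice.PBond P k, (if Inside S b then 2 * (P.mesh k ^ 2 * ‖covDeriv C (barA k A) ψ b‖ ^ 2) else 0) :=
      sum_blocks_inside_le_inside_of S hS (fun b => 2 * (P.mesh k ^ 2 * ‖covDeriv C (barA k A) ψ b‖ ^ 2))
        (fun b => by positivity) hD0
    calc ∑ y : HiggsLattice.Site P (k + 1), ∑ b : HiggsLattice.PBond P k,
          (if Inside (HiggsLattice.block y) b then ‖ψ' b.tgt - ψ' b.src‖ ^ 2 else 0)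
        ≤ ∑ y : HiggsLattice.Site P (k + 1), ((∑ b : HiggsLattice.PBond P k,
            (if Inside (HiggsLattice.block y) b then 2 * (P.mesh k ^ 2 * ‖covDeriv C (barA k A) ψ b‖ ^ 2) else 0))
          + (P.d : ℝ) * ∑ x ∈ HiggsLattice.block y, 2 * (θ ^ 2 * ‖ψ x‖ ^ 2)) :=
          Finset.sum_le_sum fun y _ => (hα y).trans (add_le_add le_rfl (hβ y))
      _ = (∑ y : HiggsLattice.Site P (k + 1), ∑ b : HiggsLattice.PBond P k,
            (if Inside (HiggsLattice.block y) b then 2 * (P.mesh k ^ 2 * ‖covDeriv C (barA k A) ψ b‖ ^ 2) else 0))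
          + ∑ y : HiggsLattice.Site P (k + 1), ((P.d : ℝ) * ∑ x ∈ HiggsLattice.block y, 2 * (θ ^ 2 * ‖ψ x‖ ^ 2)) :=
          Finset.sum_add_distrib
      _ ≤ _ := add_le_add hγ le_rfl
  -- constants out of the two sums of (4)
  have hSB : (∑ b : HiggsLattice.PBond P k, (if Inside S b then 2 * (P.mesh k ^ 2 * ‖covDeriv C (barA k A) ψ b‖ ^ 2) else 0))
      = 2 * P.mesh k ^ 2 * ∑ b : HiggsLattice.PBond P k, (if Inside S b then ‖covDeriv C (barA k A) ψ b‖ ^ 2 else 0) := by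
    rw [Finset.mul_sum]
    refine Finset.sum_congr rfl fun b _ => ?_
    split_ifs <;> ring
  have hS1 : ∑ y : HiggsLattice.Site P (k + 1), ((P.d : ℝ) * ∑ x ∈ HiggsLattice.block y, 2 * (θ ^ 2 * ‖ψ x‖ ^ 2))
      = 2 * θ ^ 2 * (P.d : ℝ) * ∑ y : HiggsLattice.Site P (k + 1), ∑ x ∈ HiggsLattice.block y, ‖ψ x‖ ^ 2 := by
    rw [Finset.mul_sum]
    refine Finset.sum_congr rfl fun y _ => ?_
    rw [Finset.mul_sum, Finset.mul_sum]
    exact Finset.sum_congr rfl fun x _ => by ring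
  rw [hSB, hS1] at h4
  -- (5) the block Poincaré inequality for `ψ′`, block by block, summed
  have hblk : ∀ y : HiggsLattice.Site P (k + 1),
      ∑ x ∈ HiggsLattice.block y, ‖ψ x‖ ^ 2 - ((P.L : ℝ) ^ P.d)⁻¹ * ‖∑ x ∈ HiggsLattice.block y, ψ' x‖ ^ 2
        ≤ (P.L : ℝ) ^ 2 / 8 *
          ∑ b : HiggsLattice.PBond P k, if Inside (HiggsLattice.block y) b then ‖ψ' b.tgt - ψ' b.src‖ ^ 2 else 0 := by
    intro y
    have h := block_poincare_vec hk y ψ'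
    simp_rw [hnorm] at h
    exact h
  have hblocks := Finset.sum_le_sum fun y (_ : y ∈ (Finset.univ : Finset (HiggsLattice.Site P (k + 1)))) => hblk y
  rw [Finset.sum_sub_distrib, ← Finset.mul_sum, ← Finset.mul_sum] at hblocks
  -- assemble
  have hL8 : 0 ≤ (P.L : ℝ) ^ 2 / 8 := by positivity
  have h4' := mul_le_mul_of_nonneg_left h4 hL8
  have key : ∑ y : HiggsLattice.Site P (k + 1), ∑ x ∈ HiggsLattice.block y, ‖ψ x‖ ^ 2
      ≤ ((P.L : ℝ) ^ P.d)⁻¹ * ∑ y : HiggsLattice.Site P (k + 1), ‖∑ x ∈ HiggsLattice.block y, ψ' x‖ ^ 2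
        + (P.L : ℝ) ^ 2 / 8 * (2 * P.mesh k ^ 2 *
            ∑ b : HiggsLattice.PBond P k, (if Inside S b then ‖covDeriv C (barA k A) ψ b‖ ^ 2 else 0)
          + 2 * θ ^ 2 * (P.d : ℝ) * ∑ y : HiggsLattice.Site P (k + 1), ∑ x ∈ HiggsLattice.block y, ‖ψ x‖ ^ 2) := by
    linarith
  have eI : (P.L : ℝ) ^ 2 / 4 * P.d * θ ^ 2 * siteInner ψ ψ = (P.L : ℝ) ^ 2 / 4 * P.d * θ ^ 2
      * (P.mesh k ^ P.d * ∑ y : HiggsLattice.Site P (k + 1), ∑ x ∈ HiggsLattice.block y, ‖ψ x‖ ^ 2) := by rw [h1]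
  rw [h3, eI, h2, h1]
  calc P.mesh k ^ P.d * ∑ y : HiggsLattice.Site P (k + 1), ∑ x ∈ HiggsLattice.block y, ‖ψ x‖ ^ 2
      ≤ P.mesh k ^ P.d * (((P.L : ℝ) ^ P.d)⁻¹ * ∑ y : HiggsLattice.Site P (k + 1), ‖∑ x ∈ HiggsLattice.block y, ψ' x‖ ^ 2
        + (P.L : ℝ) ^ 2 / 8 * (2 * P.mesh k ^ 2 *
            ∑ b : HiggsLattice.PBond P k, (if Inside S b then ‖covDeriv C (barA k A) ψ b‖ ^ 2 else 0)
          + 2 * θ ^ 2 * (P.d : ℝ) * ∑ y : HiggsLattice.Site P (k + 1), ∑ x ∈ HiggsLattice.block y, ‖ψ x‖ ^ 2)) :=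
        mul_le_mul_of_nonneg_left key hmd.le
    _ = _ := by ring

end Inside

/-! ## §4 (2.33) LOWER HALF for the printed regions `Ω = B^k(Λ_k)` with `A` REGULAR ON `Ω` ONLY -/

section Region

open B2Eq337ScalarIntegration (Regions V)
open B2Eq328ConcretePieces (LSite pieceF)
open B2Eq328DeltaK (extL)
open B2Prop31ZeroFieldConcrete (massK massK_eq_siteInner massK_nonneg extL_apply_of_not mem_pieceF_iff)
open B2Ineq329RegularField (ineq329_regular_deltaKA)
open B1Ineq233LowerZeroField (mesh_succ)
open HiggsFluctMeasurePos (siteInner_add_right siteInner_smul_right)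

variable {K : ℕ} (R : Regions P K) (C : ChargeData N) {a msq : ℝ}

/-- **(2.33) LOWER HALF AT A BACKGROUND REGULAR ON `Ω` ONLY, FOR THE PRINTED REGIONS** — the statement of
`B1Ineq233LowerBackgroundRegion.ineq233_lower_regular_region` with the regularity hypothesis LOCALIZED to `Ω = B^k(Λ_k)` exactly as
in print (*"If a configuration A is regular on Ω … |(∂^η_μA^η_ν)(x)| ≦ …, x ∈ Ω (2.23)"*) and as in p23's (II.3.29)
`ineq329_regular_deltaKA` (`∀ z ∈ pieceF R j`): for `Λ_k = R.block j` a union of blocks, `1 ≦ k = j+1 < K_P`, `L^kε ≦ 1`, the three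
smallness conditions, and EVERY `ψ : Λ_k → ℝ^N`,
`(c₁/2)(L^kε)^{−2}‖ψ̃‖² ≦ ⟨ψ̃, (a(L^{k+1}ε)^{−2}P(Ã) + Δ^{(k),L^kε}(B^k(Λ_k), Ã))ψ̃⟩`, `c₁ = min{a, 4γ₀}/L²`.
[cite: Balaban1982Higgs1, Prop. 2.3 (2.33) p.611, Prop. 2.1 (2.23) p.610] [cite: Balaban1982Higgs2, (3.29) p.590]
[cite: Balaban1983RegularityDecay, §5 (5.2)–(5.3) p.593, (1.21)–(1.22) p.574] -/
theorem ineq233_lower_regularOn_region (ha : 0 < a) (hL : 1 < P.L) (hmsq : 0 < msq) (hK : K ≤ P.K) (j : Fin K)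
    (hjK : j.val + 1 < P.K) (hN2 : ∀ μ, 2 ≤ P.sitesPerDir (j.val + 1 + 1) μ) (hs : P.mesh (j.val + 1) ≤ 1)
    (hU : ∀ y y' : HiggsLattice.Site P (j.val + 1),
      HiggsLattice.blockOf y = HiggsLattice.blockOf y' → (y ∈ R.block j ↔ y' ∈ R.block j))
    (A : HiggsLattice.VecField P 0) {δ : ℝ} (hδ : 0 ≤ δ)
    (hreg : ∀ z ∈ pieceF R j, ∀ μ' ν : Fin P.d, |A ⟨z.shift ν, μ'⟩ - A ⟨z, μ'⟩| ≤ δ)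
    (hsmall : 8 * (P.d : ℝ) ^ 4 * (P.L : ℝ) ^ P.d * C.e ^ 2 * P.mesh (j.val + 1) ^ 2 *
      ((P.L : ℝ) ^ (j.val + 1)) ^ 2 * δ ^ 2 ≤ 1 / 2)
    {γ₀ : ℝ} (hγ0 : 0 ≤ γ₀) (hγB : γ₀ * (8 * P.d + 2 * msq + 4) ≤ a * (1 - ((P.L : ℝ) ^ 2)⁻¹))
    (hγ16 : γ₀ ≤ 1 / 16)
    (hE : 64 * γ₀ * (P.d : ℝ) ^ 3 * C.e ^ 2 * ((P.L : ℝ) ^ (j.val + 1)) ^ 2 * δ ^ 2 * P.mesh (j.val + 1) ^ 2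
      ≤ min a (4 * γ₀) / (P.L : ℝ) ^ 2 / 4)
    (hθ : (P.L : ℝ) ^ 2 * P.d *
      (2 * P.d * P.L * ((P.L : ℝ) ^ (j.val + 1)) ^ 2 * (P.mesh 0 * |C.e|) * δ) ^ 2 ≤ 1)
    (ψ : LSite R j → V N) :
    min a (4 * γ₀) / (P.L : ℝ) ^ 2 / 2 * ((P.mesh (j.val + 1))⁻¹ ^ 2) * siteInner (extL R j ψ) (extL R j ψ)
      ≤ siteInner (extL R j ψ) (precOpA C (pieceF R j) A msq a (j.val + 1) (extL R j ψ)) := by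
  have hL1 : (1 : ℝ) < (P.L : ℝ) := by exact_mod_cast hL
  have hL0 : (0 : ℝ) < (P.L : ℝ) := by linarith
  have hm : 0 < P.mesh (j.val + 1) := P.mesh_pos _
  obtain ⟨S, hSdef⟩ : ∃ S, S = siteInner (extL R j ψ) (extL R j ψ) := ⟨_, rfl⟩
  obtain ⟨X, hX⟩ : ∃ X, X = siteInner (extL R j ψ) (blockProjA C A (j.val + 1) (extL R j ψ)) := ⟨_, rfl⟩
  obtain ⟨B, hB⟩ : ∃ B, B = ∑ c : HiggsLattice.PBond P (j.val + 1), (if Inside (R.block j) c then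
      P.mesh (j.val + 1) ^ P.d * ‖covDeriv C (barA (j.val + 1) A) (extL R j ψ) c‖ ^ 2 else 0) := ⟨_, rfl⟩
  obtain ⟨D, hD⟩ : ∃ D, D = siteInner (extL R j ψ) (deltaKA C (pieceF R j) A msq a (j.val + 1) (extL R j ψ)) := ⟨_, rfl⟩
  obtain ⟨θ, hθdef⟩ : ∃ θ : ℝ, θ = 2 * P.d * P.L * ((P.L : ℝ) ^ (j.val + 1)) ^ 2 * (P.mesh 0 * |C.e|) * δ := ⟨_, rfl⟩
  obtain ⟨E, hEdef⟩ : ∃ E : ℝ, E = 64 * γ₀ * (P.d : ℝ) ^ 3 * C.e ^ 2 * ((P.L : ℝ) ^ (j.val + 1)) ^ 2 * δ ^ 2 := ⟨_, rfl⟩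
  obtain ⟨c₁, hc₁⟩ : ∃ c₁ : ℝ, c₁ = min a (4 * γ₀) / (P.L : ℝ) ^ 2 := ⟨_, rfl⟩
  rw [← hθdef] at hθ
  rw [← hEdef, ← hc₁] at hE
  have hS0 : 0 ≤ S := hSdef ▸ siteInner_self_nonneg _
  have hX0 : 0 ≤ X := by rw [hX, siteInner_blockProjA_eq]; exact siteInner_self_nonneg _
  have hB0 : 0 ≤ B := by
    rw [hB]
    exact Finset.sum_nonneg fun c _ => by split_ifs <;> positivity
  have hmi0 : 0 < (P.mesh (j.val + 1))⁻¹ ^ 2 := by positivity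
  -- §1 for `ψ̃`, `S = Λ_k`
  have hsupp : ∀ y, y ∉ R.block j → extL R j ψ y = 0 := fun y hy => extL_apply_of_not R j ψ hy
  have hCP : S ≤ X + (P.L : ℝ) ^ 2 / 4 * P.mesh (j.val + 1) ^ 2 * B + (P.L : ℝ) ^ 2 / 4 * P.d * θ ^ 2 * S := by
    rw [hSdef, hX, hB, hθdef]
    exact siteInner_self_le_blockProjA_add_cov_inside_of C hjK hN2 (R.block j) hU A hδ
      (fun z hz μ' ν => hreg z ((mem_pieceF_iff R j z).mpr hz) μ' ν) (extL R j ψ) hsupp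
  -- (II.3.29) at the regular field for the region (p23), mass term dropped
  have hΔ : γ₀ * B - E * S ≤ D := by
    have h := ineq329_regular_deltaKA R C hK ha hL hmsq A j hs hδ hreg hsmall hγ0 hγB hγ16 ψ
    have hmass : 0 ≤ massK R msq j ψ := massK_nonneg R hmsq.le j ψ
    have e5 : (∑ y : LSite R j, P.mesh (j.val + 1) ^ P.d * ‖ψ y‖ ^ 2) = S := by
      have h1 := massK_eq_siteInner R 1 j ψ
      rw [one_mul, massK] at h1
      rw [hSdef, ← h1]
      exact Finset.sum_congr rfl fun y _ => by rw [mul_one]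
    rw [e5, ← hB, ← hEdef, ← hD] at h
    nlinarith [mul_nonneg hγ0 hmass]
  -- the form of `a(L^{k+1}ε)^{-2}P(Ã) + Δ^{(k)}(Ω, Ã)`
  have hprec : siteInner (extL R j ψ) (precOpA C (pieceF R j) A msq a (j.val + 1) (extL R j ψ))
      = a * ((P.mesh (j.val + 1 + 1))⁻¹ ^ 2) * X + D := by
    rw [precOpA, LinearMap.add_apply, LinearMap.smul_apply, siteInner_add_right, siteInner_smul_right, hX, hD]
  have hinv : ((P.L : ℝ) * P.mesh (j.val + 1))⁻¹ ^ 2 = ((P.L : ℝ) ^ 2)⁻¹ * (P.mesh (j.val + 1))⁻¹ ^ 2 := by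
    rw [mul_inv, mul_pow, inv_pow]
  rw [hprec, ← hSdef, ← hc₁, mesh_succ (j.val + 1), hinv]
  -- the constants
  have hc₁0 : 0 ≤ c₁ := by rw [hc₁]; exact div_nonneg (le_min ha.le (by linarith)) (by positivity)
  have hc₁a : c₁ ≤ a * ((P.L : ℝ) ^ 2)⁻¹ := by
    rw [hc₁, div_eq_mul_inv]
    exact mul_le_mul_of_nonneg_right (min_le_left _ _) (inv_nonneg.mpr (by positivity))
  have hc₁γ : c₁ * ((P.L : ℝ) ^ 2 / 4) ≤ γ₀ := by
    have hL2 : (0 : ℝ) < (P.L : ℝ) ^ 2 := by positivity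
    have e : min a (4 * γ₀) / (P.L : ℝ) ^ 2 * ((P.L : ℝ) ^ 2 / 4) = min a (4 * γ₀) / 4 := by
      rw [div_mul_div_comm, mul_comm (min a (4 * γ₀)), mul_div_mul_left _ _ hL2.ne']
    rw [hc₁, e]
    linarith [min_le_right a (4 * γ₀)]
  -- the pieces, multiplied out
  have hmm : (P.mesh (j.val + 1))⁻¹ ^ 2 * P.mesh (j.val + 1) ^ 2 = 1 := by field_simp
  have F1 : c₁ * (P.mesh (j.val + 1))⁻¹ ^ 2 * S ≤ c₁ * (P.mesh (j.val + 1))⁻¹ ^ 2 * X + c₁ * ((P.L : ℝ) ^ 2 / 4) * B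
      + c₁ * (P.mesh (j.val + 1))⁻¹ ^ 2 * ((P.L : ℝ) ^ 2 / 4 * P.d * θ ^ 2 * S) := by
    have h := mul_le_mul_of_nonneg_left hCP (mul_nonneg hc₁0 hmi0.le)
    have e : c₁ * (P.mesh (j.val + 1))⁻¹ ^ 2 * (X + (P.L : ℝ) ^ 2 / 4 * P.mesh (j.val + 1) ^ 2 * B
        + (P.L : ℝ) ^ 2 / 4 * P.d * θ ^ 2 * S)
        = c₁ * (P.mesh (j.val + 1))⁻¹ ^ 2 * X
          + c₁ * ((P.L : ℝ) ^ 2 / 4) * ((P.mesh (j.val + 1))⁻¹ ^ 2 * P.mesh (j.val + 1) ^ 2) * B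
          + c₁ * (P.mesh (j.val + 1))⁻¹ ^ 2 * ((P.L : ℝ) ^ 2 / 4 * P.d * θ ^ 2 * S) := by ring
    rw [hmm, mul_one] at e
    linarith
  have F2 : c₁ * ((P.mesh (j.val + 1))⁻¹ ^ 2 * X) ≤ a * ((P.L : ℝ) ^ 2)⁻¹ * ((P.mesh (j.val + 1))⁻¹ ^ 2 * X) :=
    mul_le_mul_of_nonneg_right hc₁a (mul_nonneg hmi0.le hX0)
  have F3 : c₁ * ((P.L : ℝ) ^ 2 / 4) * B ≤ γ₀ * B := mul_le_mul_of_nonneg_right hc₁γ hB0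
  have F6 : E * S + c₁ * (P.mesh (j.val + 1))⁻¹ ^ 2 * ((P.L : ℝ) ^ 2 / 4 * P.d * θ ^ 2 * S)
      ≤ c₁ / 2 * (P.mesh (j.val + 1))⁻¹ ^ 2 * S := by
    have h1 : E ≤ c₁ / 4 * (P.mesh (j.val + 1))⁻¹ ^ 2 := by
      have e : E * P.mesh (j.val + 1) ^ 2 * (P.mesh (j.val + 1))⁻¹ ^ 2 = E := by field_simp
      calc E = E * P.mesh (j.val + 1) ^ 2 * (P.mesh (j.val + 1))⁻¹ ^ 2 := e.symm
        _ ≤ c₁ / 4 * (P.mesh (j.val + 1))⁻¹ ^ 2 := mul_le_mul_of_nonneg_right hE hmi0.le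
    have h2 : (P.L : ℝ) ^ 2 / 4 * P.d * θ ^ 2 ≤ 1 / 4 := by linarith
    have h3 : c₁ * (P.mesh (j.val + 1))⁻¹ ^ 2 * ((P.L : ℝ) ^ 2 / 4 * P.d * θ ^ 2 * S)
        ≤ c₁ * (P.mesh (j.val + 1))⁻¹ ^ 2 * (1 / 4 * S) :=
      mul_le_mul_of_nonneg_left (mul_le_mul_of_nonneg_right h2 hS0) (mul_nonneg hc₁0 hmi0.le)
    have h4 : E * S ≤ c₁ / 4 * (P.mesh (j.val + 1))⁻¹ ^ 2 * S := mul_le_mul_of_nonneg_right h1 hS0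
    linarith
  linarith

end Region

/-! ## §5 Level `k = 0`: a union of blocks `Ω ⊂ T_ε`, `A` regular on `Ω` only -/

section LevelZeroRegion

open B2Eq255Concrete (barA_zero_level)
open B1Ineq233LowerZeroField (mesh_succ)
open HiggsFluctMeasurePos (siteInner_add_right siteInner_smul_right)

variable (C : ChargeData N) (Ω : Finset (HiggsLattice.Site P 0)) {a msq : ℝ}

/-- **(2.33), LOWER HALF, LEVEL `0`, FOR A UNION OF BLOCKS `Ω ⊂ T_ε`, `A` REGULAR ON `Ω` ONLY** (`a, m² ≥ 0`, `0 < K`, at least two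
level-`1` sites per direction, `|A(z + εe_ν, μ′) − A(z, μ′)| ≤ δ` for `z ∈ Ω` with `L²dθ₀² ≤ 1`, `θ₀ = 2dL·ε|e|δ`): for every `ψ`
vanishing off `Ω`, `(3c₁⁰/4)ε^{−2}‖ψ‖² ≤ ⟨ψ, (a(Lε)^{−2}P(A) + Δ^{(0),ε}(Ω, A))ψ⟩`, `c₁⁰ = min{a, 4}/L²` — the sibling's
`ineq233_lower_regular_region_levelZero` with the printed locality of the hypothesis (§3 at `k = 0`, `Ā^{(0)} = A`, + (2.17)).
[cite: Balaban1982Higgs1, Prop. 2.3 (2.33) p.611, (2.23) p.610; (2.17) p.610] [cite: Balaban1983RegularityDecay, §5 (5.2)–(5.3) p.593] -/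
theorem ineq233_lower_regularOn_region_levelZero (ha : 0 ≤ a) (hmsq : 0 ≤ msq) (hK : 0 < P.K)
    (hN2 : ∀ μ, 2 ≤ P.sitesPerDir 1 μ)
    (hU : ∀ x x' : HiggsLattice.Site P 0, HiggsLattice.blockOf x = HiggsLattice.blockOf x' → (x ∈ Ω ↔ x' ∈ Ω))
    (A : HiggsLattice.VecField P 0) {δ : ℝ} (hδ : 0 ≤ δ)
    (hreg : ∀ z ∈ Ω, ∀ μ' ν : Fin P.d, |A ⟨z.shift ν, μ'⟩ - A ⟨z, μ'⟩| ≤ δ)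
    (hθ : (P.L : ℝ) ^ 2 * P.d * (2 * P.d * P.L * (P.mesh 0 * |C.e|) * δ) ^ 2 ≤ 1)
    (ψ : ScalarField P 0 N) (hψ : ∀ x, x ∉ Ω → ψ x = 0) :
    3 * (min a 4 / (P.L : ℝ) ^ 2) / 4 * ((P.mesh 0)⁻¹ ^ 2) * siteInner ψ ψ
      ≤ siteInner ψ (precOpA C Ω A msq a 0 ψ) := by
  have hL1 : (1 : ℝ) ≤ (P.L : ℝ) := by exact_mod_cast P.hL
  have hL0 : (0 : ℝ) < (P.L : ℝ) := by linarith
  have hm : 0 < P.mesh 0 := P.mesh_pos 0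
  obtain ⟨S, hS⟩ : ∃ S, S = siteInner ψ ψ := ⟨_, rfl⟩
  obtain ⟨X, hX⟩ : ∃ X, X = siteInner ψ (blockProjA C A 0 ψ) := ⟨_, rfl⟩
  obtain ⟨B, hB⟩ : ∃ B, B = ∑ b : HiggsLattice.PBond P 0,
      (if Inside Ω b then P.mesh 0 ^ P.d * ‖covDeriv C A ψ b‖ ^ 2 else 0) := ⟨_, rfl⟩
  obtain ⟨D, hD⟩ : ∃ D, D = siteInner ψ (deltaKA C Ω A msq a 0 ψ) := ⟨_, rfl⟩
  obtain ⟨θ, hθdef⟩ : ∃ θ : ℝ, θ = 2 * P.d * P.L * (P.mesh 0 * |C.e|) * δ := ⟨_, rfl⟩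
  obtain ⟨c₁, hc₁⟩ : ∃ c₁ : ℝ, c₁ = min a 4 / (P.L : ℝ) ^ 2 := ⟨_, rfl⟩
  rw [← hθdef] at hθ
  have hS0 : 0 ≤ S := hS ▸ siteInner_self_nonneg ψ
  have hX0 : 0 ≤ X := by rw [hX, siteInner_blockProjA_eq]; exact siteInner_self_nonneg _
  have hB0 : 0 ≤ B := by
    rw [hB]
    exact Finset.sum_nonneg fun c _ => by split_ifs <;> positivity
  have hmi0 : 0 < (P.mesh 0)⁻¹ ^ 2 := by positivity
  -- §3 at level 0 (`blockIter 0 z = z`), `Ā^{(0)} = A`, `(L^0)^2 = 1`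
  have hCP : S ≤ X + (P.L : ℝ) ^ 2 / 4 * P.mesh 0 ^ 2 * B + (P.L : ℝ) ^ 2 / 4 * P.d * θ ^ 2 * S := by
    have h := siteInner_self_le_blockProjA_add_cov_inside_of C hK hN2 Ω hU A hδ (fun z hz μ' ν => hreg z hz μ' ν) ψ hψ
    rw [barA_zero_level, pow_zero, one_pow, mul_one] at h
    rw [hS, hX, hB, hθdef]; exact h
  -- (2.17) for the region
  have hΔ : B + msq * S = D := by
    rw [hB, hS, hD]
    simp only [deltaKA_zero, delta0, LinearMap.add_apply, LinearMap.smul_apply, LinearMap.id_apply,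
      siteInner_add_right, siteInner_smul_right]
    rw [siteInner_covLaplacianN C Ω A ψ ψ]
    congr 1
    refine Finset.sum_congr rfl fun b _ => ?_
    split_ifs
    · rw [real_inner_self_eq_norm_sq]
    · rfl
  have hprec : siteInner ψ (precOpA C Ω A msq a 0 ψ) = a * ((P.mesh (0 + 1))⁻¹ ^ 2) * X + D := by
    rw [precOpA, LinearMap.add_apply, LinearMap.smul_apply, siteInner_add_right, siteInner_smul_right, hX, hD]
  have hinv : ((P.L : ℝ) * P.mesh 0)⁻¹ ^ 2 = ((P.L : ℝ) ^ 2)⁻¹ * (P.mesh 0)⁻¹ ^ 2 := by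
    rw [mul_inv, mul_pow, inv_pow]
  rw [hprec, ← hS, ← hc₁, mesh_succ 0, hinv]
  -- the constants
  have hc₁0 : 0 ≤ c₁ := by rw [hc₁]; exact div_nonneg (le_min ha (by norm_num)) (by positivity)
  have hc₁a : c₁ ≤ a * ((P.L : ℝ) ^ 2)⁻¹ := by
    rw [hc₁, div_eq_mul_inv]
    exact mul_le_mul_of_nonneg_right (min_le_left _ _) (inv_nonneg.mpr (by positivity))
  have hc₁γ : c₁ * ((P.L : ℝ) ^ 2 / 4) ≤ 1 := by
    have hL2 : (0 : ℝ) < (P.L : ℝ) ^ 2 := by positivity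
    have e : min a 4 / (P.L : ℝ) ^ 2 * ((P.L : ℝ) ^ 2 / 4) = min a 4 / 4 := by
      rw [div_mul_div_comm, mul_comm (min a 4), mul_div_mul_left _ _ hL2.ne']
    rw [hc₁, e]
    linarith [min_le_right a 4]
  -- the pieces, multiplied out
  have hmm : (P.mesh 0)⁻¹ ^ 2 * P.mesh 0 ^ 2 = 1 := by field_simp
  have F1 : c₁ * (P.mesh 0)⁻¹ ^ 2 * S ≤ c₁ * (P.mesh 0)⁻¹ ^ 2 * X + c₁ * ((P.L : ℝ) ^ 2 / 4) * B
      + c₁ * (P.mesh 0)⁻¹ ^ 2 * ((P.L : ℝ) ^ 2 / 4 * P.d * θ ^ 2 * S) := by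
    have h := mul_le_mul_of_nonneg_left hCP (mul_nonneg hc₁0 hmi0.le)
    have e : c₁ * (P.mesh 0)⁻¹ ^ 2 * (X + (P.L : ℝ) ^ 2 / 4 * P.mesh 0 ^ 2 * B + (P.L : ℝ) ^ 2 / 4 * P.d * θ ^ 2 * S)
        = c₁ * (P.mesh 0)⁻¹ ^ 2 * X + c₁ * ((P.L : ℝ) ^ 2 / 4) * ((P.mesh 0)⁻¹ ^ 2 * P.mesh 0 ^ 2) * B
          + c₁ * (P.mesh 0)⁻¹ ^ 2 * ((P.L : ℝ) ^ 2 / 4 * P.d * θ ^ 2 * S) := by ring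
    rw [hmm, mul_one] at e
    linarith
  have F2 : c₁ * ((P.mesh 0)⁻¹ ^ 2 * X) ≤ a * ((P.L : ℝ) ^ 2)⁻¹ * ((P.mesh 0)⁻¹ ^ 2 * X) :=
    mul_le_mul_of_nonneg_right hc₁a (mul_nonneg hmi0.le hX0)
  have F3 : c₁ * ((P.L : ℝ) ^ 2 / 4) * B ≤ 1 * B := mul_le_mul_of_nonneg_right hc₁γ hB0
  have F5 : 0 ≤ msq * S := mul_nonneg hmsq hS0
  have F6 : c₁ * (P.mesh 0)⁻¹ ^ 2 * ((P.L : ℝ) ^ 2 / 4 * P.d * θ ^ 2 * S) ≤ c₁ * (P.mesh 0)⁻¹ ^ 2 * (1 / 4 * S) := by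
    have h2 : (P.L : ℝ) ^ 2 / 4 * P.d * θ ^ 2 ≤ 1 / 4 := by linarith
    exact mul_le_mul_of_nonneg_left (mul_le_mul_of_nonneg_right h2 hS0) (mul_nonneg hc₁0 hmi0.le)
  linarith

end LevelZeroRegion

/-! ## §6 The printed shape: «A regular on Ω» as in (2.23) and «for e sufficiently small» -/

section Printed

open B2Eq337ScalarIntegration (Regions V)
open B2Eq328ConcretePieces (LSite pieceF)
open B2Eq328DeltaK (extL)
open B2Ineq329RegularField (gamma0_regular_spec)

/-- **(2.33) LOWER HALF IN THE PRINTED SHAPE** — *"If a configuration A is regular on Ω … then there exist positive constants … γ₀ …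
dependent on d and a, and independent of A, k, Ω and Λ"* ([B1] p. 611) obtained *"for e sufficiently small"* ([B4] p. 593).  For `d`, `L`,
`a, m² > 0` and a regularity constant `c` there are `E₀ > 0` and `γ > 0` (functions of `d, L, a, m², c`) such that for every charge with
`e² ≤ E₀`, every torus of the family, every region tower `R`, every level `1 ≦ k = j+1 < K_P` with `Λ_k = R.block j` a union of blocks and
`L^kε ≦ 1`, every `A` REGULAR ON `Ω = B^k(Λ_k)` in the sense `|A(z + εe_ν, μ′) − A(z, μ′)| ≦ δ` (`z ∈ Ω`) with `L^k·δ ≦ c·|e|` — which is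
(2.23) `|(∂^ηA)(x)| ≦ ce(L^kε)^{β−1}`, `x ∈ Ω`, in lattice units (`δ = ε·ce(L^kε)^{β−1}`, so `L^kδ = ce(L^kε)^β ≦ ce` for `β ≧ 0`) — and EVERY
`ψ : Λ_k → ℝ^N`: `γ(L^kε)^{−2}‖ψ̃‖² ≦ ⟨ψ̃, (a(L^{k+1}ε)^{−2}P(A) + Δ^{(k),L^kε}(B^k(Λ_k), A))ψ̃⟩`; `γ = min{a, 4γ₀}/(2L²)` with p23's
`γ₀ = min{a(1 − L^{−2})/(8d + 2m² + 4), 1/16}`. [cite: Balaban1982Higgs1, Prop. 2.3 (2.33) p.611, Prop. 2.1 (2.23) p.610]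
[cite: Balaban1983RegularityDecay, §5 (5.2)–(5.3) p.593, Prop. 3.1′ (1.21)–(1.22) p.574] [cite: Balaban1982Higgs2, (3.29) p.590] -/
theorem ineq233_lower_printed_region (d L : ℕ) (hL1 : 1 < L) {a msq : ℝ} (ha : 0 < a) (hmsq : 0 < msq) (c : ℝ) (N : ℕ) :
    ∃ E₀ : ℝ, 0 < E₀ ∧ ∃ γ : ℝ, 0 < γ ∧
      ∀ (C : ChargeData N), C.e ^ 2 ≤ E₀ →
      ∀ (P : HiggsLattice.Params), P.d = d → P.L = L →
      ∀ {K : ℕ} (R : Regions P K), K ≤ P.K → ∀ (j : Fin K), j.val + 1 < P.K →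
      (∀ μ, 2 ≤ P.sitesPerDir (j.val + 1 + 1) μ) → P.mesh (j.val + 1) ≤ 1 →
      (∀ y y' : HiggsLattice.Site P (j.val + 1),
        HiggsLattice.blockOf y = HiggsLattice.blockOf y' → (y ∈ R.block j ↔ y' ∈ R.block j)) →
      ∀ (A : HiggsLattice.VecField P 0) {δ : ℝ}, 0 ≤ δ →
        (∀ z ∈ pieceF R j, ∀ μ' ν : Fin P.d, |A ⟨z.shift ν, μ'⟩ - A ⟨z, μ'⟩| ≤ δ) →
        (P.L : ℝ) ^ (j.val + 1) * δ ≤ c * |C.e| →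
        ∀ ψ : LSite R j → V N,
          γ * ((P.mesh (j.val + 1))⁻¹ ^ 2) * siteInner (extL R j ψ) (extL R j ψ)
            ≤ siteInner (extL R j ψ) (precOpA C (pieceF R j) A msq a (j.val + 1) (extL R j ψ)) := by
  obtain ⟨γ₀, hγ₀⟩ : ∃ γ₀ : ℝ, γ₀ = min (a * (1 - ((L : ℝ) ^ 2)⁻¹) / (8 * (d : ℝ) + 2 * msq + 4)) (1 / 16) := ⟨_, rfl⟩
  obtain ⟨c₁, hc₁⟩ : ∃ c₁ : ℝ, c₁ = min a (4 * γ₀) / (L : ℝ) ^ 2 := ⟨_, rfl⟩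
  obtain ⟨E, hE⟩ : ∃ E : ℝ, E = min 1 (min (1 / (16 * ((d : ℝ) ^ 4 * (L : ℝ) ^ d * c ^ 2) + 1))
      (min (c₁ / (256 * (γ₀ * (d : ℝ) ^ 3 * c ^ 2) + 1)) (1 / (4 * ((d : ℝ) ^ 3 * (L : ℝ) ^ 4 * c ^ 2) + 1)))) := ⟨_, rfl⟩
  have hLr : (1 : ℝ) < (L : ℝ) := by exact_mod_cast hL1
  have hγ₀pos : 0 < γ₀ := by
    rw [hγ₀]
    refine lt_min (div_pos (mul_pos ha ?_) (by positivity)) (by norm_num)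
    have h1 : (1 : ℝ) < (L : ℝ) ^ 2 := by
      have h := mul_lt_mul hLr hLr.le zero_lt_one (zero_le_one.trans hLr.le)
      rw [one_mul] at h; rw [sq]; exact h
    have : ((L : ℝ) ^ 2)⁻¹ < 1 := inv_lt_one_of_one_lt₀ h1
    linarith
  have hc₁pos : 0 < c₁ := by rw [hc₁]; exact div_pos (lt_min ha (by linarith)) (by positivity)
  have hX0 : 0 ≤ (d : ℝ) ^ 4 * (L : ℝ) ^ d * c ^ 2 := by positivity
  have hY0 : 0 ≤ γ₀ * (d : ℝ) ^ 3 * c ^ 2 := by positivity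
  have hZ0 : 0 ≤ (d : ℝ) ^ 3 * (L : ℝ) ^ 4 * c ^ 2 := by positivity
  have hEpos : 0 < E := by
    rw [hE]
    exact lt_min one_pos (lt_min (by positivity) (lt_min (div_pos hc₁pos (by positivity)) (by positivity)))
  refine ⟨E, hEpos, c₁ / 2, by linarith, ?_⟩
  intro C heE P hPd hPL K R hK j hjK hN2 hs hU A δ hδ hreg hu ψ
  subst hPd hPL
  have hLnat : 1 < P.L := hL1
  have hmesh : 0 < P.mesh (j.val + 1) := P.mesh_pos _
  have hmeshK : P.mesh (j.val + 1) = (P.L : ℝ) ^ (j.val + 1) * P.mesh 0 := by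
    unfold HiggsLattice.Params.mesh; ring
  have hE1 : E ≤ 1 := by rw [hE]; exact min_le_left _ _
  have he2 : C.e ^ 2 ≤ 1 := heE.trans hE1
  have hu0 : 0 ≤ (P.L : ℝ) ^ (j.val + 1) * δ := by positivity
  -- the basic square: `(Lᵏδ)²·e² ≤ c²·E`
  have hsq : ((P.L : ℝ) ^ (j.val + 1) * δ) ^ 2 * C.e ^ 2 ≤ c ^ 2 * E := by
    have h1 : ((P.L : ℝ) ^ (j.val + 1) * δ) ^ 2 ≤ c ^ 2 * C.e ^ 2 :=
      calc ((P.L : ℝ) ^ (j.val + 1) * δ) ^ 2 ≤ (c * |C.e|) ^ 2 := pow_le_pow_left₀ hu0 hu 2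
        _ = c ^ 2 * C.e ^ 2 := by rw [mul_pow, sq_abs]
    have h2 : C.e ^ 2 * C.e ^ 2 ≤ E :=
      calc C.e ^ 2 * C.e ^ 2 ≤ E * 1 := mul_le_mul heE he2 (sq_nonneg _) hEpos.le
        _ = E := mul_one E
    calc ((P.L : ℝ) ^ (j.val + 1) * δ) ^ 2 * C.e ^ 2 ≤ c ^ 2 * C.e ^ 2 * C.e ^ 2 :=
          mul_le_mul_of_nonneg_right h1 (sq_nonneg _)
      _ = c ^ 2 * (C.e ^ 2 * C.e ^ 2) := by ring
      _ ≤ c ^ 2 * E := mul_le_mul_of_nonneg_left h2 (sq_nonneg c)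
  -- the constant `γ₀` of (II.3.29) at a regular field
  obtain ⟨-, hγB, hγ16⟩ := gamma0_regular_spec (P := P) ha hLnat hmsq.le
  rw [← hγ₀] at hγB hγ16
  -- (i) `hsmall`
  have hsmall : 8 * (P.d : ℝ) ^ 4 * (P.L : ℝ) ^ P.d * C.e ^ 2 * P.mesh (j.val + 1) ^ 2 *
      ((P.L : ℝ) ^ (j.val + 1)) ^ 2 * δ ^ 2 ≤ 1 / 2 := by
    have hEX : E ≤ 1 / (16 * ((P.d : ℝ) ^ 4 * (P.L : ℝ) ^ P.d * c ^ 2) + 1) := by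
      rw [hE]; exact (min_le_right _ _).trans (min_le_left _ _)
    rw [le_div_iff₀ (by positivity)] at hEX
    have hs2 : P.mesh (j.val + 1) ^ 2 ≤ 1 := pow_le_one₀ hmesh.le hs
    calc 8 * (P.d : ℝ) ^ 4 * (P.L : ℝ) ^ P.d * C.e ^ 2 * P.mesh (j.val + 1) ^ 2 * ((P.L : ℝ) ^ (j.val + 1)) ^ 2 * δ ^ 2
        = 8 * ((P.d : ℝ) ^ 4 * (P.L : ℝ) ^ P.d) * (((P.L : ℝ) ^ (j.val + 1) * δ) ^ 2 * C.e ^ 2) * P.mesh (j.val + 1) ^ 2 := by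
          ring
      _ ≤ 8 * ((P.d : ℝ) ^ 4 * (P.L : ℝ) ^ P.d) * (c ^ 2 * E) * 1 := by
          refine mul_le_mul (mul_le_mul_of_nonneg_left hsq (by positivity)) hs2 (sq_nonneg _) (by positivity)
      _ = 8 * (((P.d : ℝ) ^ 4 * (P.L : ℝ) ^ P.d * c ^ 2) * E) := by ring
      _ ≤ 1 / 2 := by linarith [mul_nonneg hX0 hEpos.le]
  -- (ii) `hE`
  have hEE : 64 * γ₀ * (P.d : ℝ) ^ 3 * C.e ^ 2 * ((P.L : ℝ) ^ (j.val + 1)) ^ 2 * δ ^ 2 * P.mesh (j.val + 1) ^ 2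
      ≤ min a (4 * γ₀) / (P.L : ℝ) ^ 2 / 4 := by
    have hEY : E ≤ c₁ / (256 * (γ₀ * (P.d : ℝ) ^ 3 * c ^ 2) + 1) := by
      rw [hE]; exact (min_le_right _ _).trans ((min_le_right _ _).trans (min_le_left _ _))
    rw [le_div_iff₀ (by positivity)] at hEY
    have hs2 : P.mesh (j.val + 1) ^ 2 ≤ 1 := pow_le_one₀ hmesh.le hs
    rw [← hc₁]
    calc 64 * γ₀ * (P.d : ℝ) ^ 3 * C.e ^ 2 * ((P.L : ℝ) ^ (j.val + 1)) ^ 2 * δ ^ 2 * P.mesh (j.val + 1) ^ 2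
        = 64 * (γ₀ * (P.d : ℝ) ^ 3) * (((P.L : ℝ) ^ (j.val + 1) * δ) ^ 2 * C.e ^ 2) * P.mesh (j.val + 1) ^ 2 := by ring
      _ ≤ 64 * (γ₀ * (P.d : ℝ) ^ 3) * (c ^ 2 * E) * 1 := by
          refine mul_le_mul (mul_le_mul_of_nonneg_left hsq (by positivity)) hs2 (sq_nonneg _) (by positivity)
      _ = 64 * ((γ₀ * (P.d : ℝ) ^ 3 * c ^ 2) * E) := by ring
      _ ≤ c₁ / 4 := by linarith [mul_nonneg hY0 hEpos.le]
  -- (iii) `hθ`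
  have hθ : (P.L : ℝ) ^ 2 * P.d *
      (2 * P.d * P.L * ((P.L : ℝ) ^ (j.val + 1)) ^ 2 * (P.mesh 0 * |C.e|) * δ) ^ 2 ≤ 1 := by
    have hEZ : E ≤ 1 / (4 * ((P.d : ℝ) ^ 3 * (P.L : ℝ) ^ 4 * c ^ 2) + 1) := by
      rw [hE]; exact (min_le_right _ _).trans ((min_le_right _ _).trans (min_le_right _ _))
    rw [le_div_iff₀ (by positivity)] at hEZ
    have hs2 : P.mesh (j.val + 1) ^ 2 ≤ 1 := pow_le_one₀ hmesh.le hs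
    have e1 : ((P.L : ℝ) ^ (j.val + 1)) ^ 2 * P.mesh 0 * δ = ((P.L : ℝ) ^ (j.val + 1) * δ) * P.mesh (j.val + 1) := by
      rw [hmeshK]; ring
    calc (P.L : ℝ) ^ 2 * P.d * (2 * P.d * P.L * ((P.L : ℝ) ^ (j.val + 1)) ^ 2 * (P.mesh 0 * |C.e|) * δ) ^ 2
        = 4 * ((P.d : ℝ) ^ 3 * (P.L : ℝ) ^ 4) * ((((P.L : ℝ) ^ (j.val + 1)) ^ 2 * P.mesh 0 * δ) ^ 2 * |C.e| ^ 2) := by ring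
      _ = 4 * ((P.d : ℝ) ^ 3 * (P.L : ℝ) ^ 4) * ((((P.L : ℝ) ^ (j.val + 1) * δ) ^ 2 * C.e ^ 2) * P.mesh (j.val + 1) ^ 2) := by
          rw [e1, sq_abs]; ring
      _ ≤ 4 * ((P.d : ℝ) ^ 3 * (P.L : ℝ) ^ 4) * ((c ^ 2 * E) * 1) := by
          refine mul_le_mul_of_nonneg_left ?_ (by positivity)
          exact mul_le_mul hsq hs2 (sq_nonneg _) (by positivity)
      _ = 4 * (((P.d : ℝ) ^ 3 * (P.L : ℝ) ^ 4 * c ^ 2) * E) := by ring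
      _ ≤ 1 := by linarith [mul_nonneg hZ0 hEpos.le]
  have hmain := ineq233_lower_regularOn_region R C ha hLnat hmsq hK j hjK hN2 hs hU A hδ hreg hsmall hγ₀pos.le hγB hγ16 hEE
    hθ ψ
  rw [← hc₁] at hmain
  exact hmain

end Printed

end Literature.MathematicalPhysics.QuantumFieldTheory.Balaban1983to89.B1Ineq233LowerRegularOnRegion

end
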